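import Mathlib.Algebra.Group.Nat.Hom
import Literature.AlgebraicGeometry.Frobenioids.PadicFrobenioidThm12
import Literature.AlgebraicGeometry.Frobenioids.PadicLocalDiscreteValuation
import HarnessLib

/-!
# Frobenioids II, Example 1.1 (i): `Φ₀` and `B₀` are monoids on a base of FSM-type

Mochizuki, *The geometry of Frobenioids II*, Kyushu J. Math. **62** (2008), §1, Example 1.1 (i),
kurims p. 7 [cite: MochizukiFrdII2008, Ex 1.1 (i) p.7]: "the assignment `Spec(K) ↦ ord(O_K^⊳)^rlf`
… determines a *monoid* `Φ₀` on `D₀` [cf. [FrdI], Definition 1.1, (ii)] … the assignment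
`Spec(K) ↦ K^×` determines a group-like monoid `B₀` on `D₀`". PROOF-ONLY (node `FrdII:Ex1.1(i)`, seat
abc-iut-L1-d8): for a base functor `D → D₀` from a category of FSM-type (as `D₀` itself is, p. 7:
"of FSM-, hence also of FSMFF-type") into `p`-adic local fields (abc-iut-L1-t4's `IsPadicLocal`), the
restricted functors `Φ₀|_D = phiZeroOn base` and `B₀|_D = bZeroOn base` are monoids on `D` in the sense
of [FrdI] Def. 1.1 (ii): (a) pull-backs are characteristically injective — for `Φ₀` because
`ord(O_L^⊳) → ord(O_K^⊳)` is injective along a valuative `L → K` and both are `ℤ`-monoprime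
(abc-iut-L1-d10's discreteness `isZMonoprime_ordInt`), and an injective map of `ℤ`-monoprime monoids
realifies injectively (every `ℝ_{≥0}`-valued homomorphism extends along it); (b) FSM-morphisms of `D`
are isomorphisms, hence pull back to isomorphisms. Consequently the standing hypothesis
`Datum.IsMonoidData` (abc-iut-L1-t4, `PadicFrobenioidThm12.lean`) holds for `Datum.zero` over such a
base (`Datum.zero_isMonoidData`). No definitions.
-/

namespace Literature.AlgebraicGeometry.Frobenioids

open CategoryTheory Opposite Function ValuativeRel

universe v u

/-! ### Realification of an injective map of `ℤ`-monoprime monoids is injective -/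

section Realification

variable {M N : Type u} [CommMonoid M] [CommMonoid N]

/-- A homomorphism `Λ_{≥0} ≅ M → N ≅ Λ'_{≥0}` of `ℤ`-monoprime monoids is `n ↦ k n` in coordinates.
[cite: MochizukiFrdI2008, §0 p.10] -/
private theorem apply_eq_pow_of_isZMonoprime (eM : M ≃* Multiplicative ℕ) (eN : N ≃* Multiplicative ℕ)
    (φ : M →* N) (m : M) :
    Multiplicative.toAdd (eN (φ m)) =
      Multiplicative.toAdd (eN (φ (eM.symm (Multiplicative.ofAdd 1)))) * Multiplicative.toAdd (eM m) := by
  set ψ : Multiplicative ℕ →* Multiplicative ℕ := eN.toMonoidHom.comp (φ.comp eM.symm.toMonoidHom)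
    with hψ
  have h := MonoidHom.apply_mnat ψ (eM m)
  have h1 : ψ (eM m) = eN (φ m) := by simp [hψ]
  have h2 : ψ (Multiplicative.ofAdd 1) = eN (φ (eM.symm (Multiplicative.ofAdd 1))) := by simp [hψ]
  rw [h1, h2] at h
  have := congrArg Multiplicative.toAdd h
  rw [toAdd_pow, smul_eq_mul, mul_comm] at this
  exact this

/-- An injective homomorphism of `ℤ`-monoprime monoids induces an injective map on realifications
`M ⊗ ℝ_{≥0} → N ⊗ ℝ_{≥0}`: every `ℝ_{≥0}`-valued homomorphism on `M ≅ ℤ_{≥0}` extends along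
`φ = (n ↦ k n)`, `k ≥ 1`, by `m ↦ m · r / k`. [cite: MochizukiFrdI2008, §0 p.10] -/
theorem Realification.map_injective_of_isZMonoprime (hM : IsZMonoprime M) (hN : IsZMonoprime N)
    (φ : M →* N) (hφ : Injective φ) : Injective (Realification.map φ) := by
  obtain ⟨⟨eM⟩⟩ := hM
  obtain ⟨⟨eN⟩⟩ := hN
  set k : ℕ := Multiplicative.toAdd (eN (φ (eM.symm (Multiplicative.ofAdd 1)))) with hk
  have hk0 : k ≠ 0 := by
    intro h0
    have h1 : eN (φ (eM.symm (Multiplicative.ofAdd 1))) = 1 :=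
      Multiplicative.toAdd.injective (by rw [toAdd_one]; exact h0)
    have h2 : φ (eM.symm (Multiplicative.ofAdd 1)) = 1 := eN.injective (by rw [h1, map_one])
    have h3 : eM.symm (Multiplicative.ofAdd 1) = 1 := hφ (by rw [h2, map_one])
    have h4 := congrArg (fun x => Multiplicative.toAdd (eM x)) h3
    simp only [MulEquiv.apply_symm_apply, toAdd_ofAdd, map_one, toAdd_one] at h4
    exact one_ne_zero h4
  -- every `f : M →* ℝ_{≥0}` extends along `φ`
  have hext : ∀ f : RDual M, ∃ g : RDual N, g.comp φ = f := by
    intro f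
    let r : NNReal := Multiplicative.toAdd (f (eM.symm (Multiplicative.ofAdd 1)))
    let s : Multiplicative NNReal := Multiplicative.ofAdd (r / k)
    refine ⟨(powersHom (Multiplicative NNReal) s).comp eN.toMonoidHom, MonoidHom.ext fun m => ?_⟩
    have hf : f m = Multiplicative.ofAdd (Multiplicative.toAdd (eM m) • r) := by
      have h := MonoidHom.apply_mnat (f.comp eM.symm.toMonoidHom) (eM m)
      simp only [MonoidHom.comp_apply, MulEquiv.coe_toMonoidHom, MulEquiv.symm_apply_apply] at h
      rw [h]
      exact Multiplicative.toAdd.injective (by simp [r, toAdd_pow])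
    rw [MonoidHom.comp_apply, MonoidHom.comp_apply, MulEquiv.coe_toMonoidHom, powersHom_apply, hf]
    apply Multiplicative.toAdd.injective
    rw [toAdd_pow, toAdd_ofAdd, apply_eq_pow_of_isZMonoprime eM eN φ m, ← hk, toAdd_ofAdd]
    show (k * Multiplicative.toAdd (eM m)) • (r / k : NNReal) = Multiplicative.toAdd (eM m) • r
    rw [nsmul_eq_mul, nsmul_eq_mul, Nat.cast_mul]
    field_simp
  intro F F' hFF'
  refine MonoidHom.ext fun f => ?_
  obtain ⟨g, hg⟩ := hext f
  have h := congrArg (fun Ψ : Realification N => (show RDual (RDual N) from Ψ) g) hFF'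
  change (show RDual (RDual M) from F) (g.comp φ) = (show RDual (RDual M) from F') (g.comp φ) at h
  rw [hg] at h
  exact h

/-- An injective homomorphism into a sharp monoid is characteristically injective (the induced map on
`M/M^×` is injective as soon as associated images force equal images). [cite: MochizukiFrdI2008, §0 p.11] -/
theorem isCharInjective_of_injective_of_isSharp (φ : M →* N) (hφ : Injective φ) (hN : IsSharp N) :
    IsCharInjective φ := by
  refine ⟨hφ, fun x y hxy => ?_⟩
  obtain ⟨a, rfl⟩ := Associates.mk_surjective x
  obtain ⟨b, rfl⟩ := Associates.mk_surjective y
  rw [associatesMap_mk, associatesMap_mk, Associates.mk_eq_mk_iff_associated] at hxy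
  obtain ⟨u, hu⟩ := hxy
  have hu1 : (u : N) = 1 := hN.1 _ u.isUnit
  rw [hu1, mul_one] at hu
  rw [hφ hu]

/-- An `ℝ`-monoprime monoid is sharp (`ℝ_{≥0}` has no units but `0`). [cite: MochizukiFrdI2008, §0 p.10] -/
theorem IsRMonoprime.isSharp (h : IsRMonoprime M) : IsSharp M := by
  obtain ⟨⟨e⟩⟩ := h
  refine ⟨fun a ha => ?_⟩
  obtain ⟨u, rfl⟩ := ha
  have hsum : Multiplicative.toAdd (e (u : M)) + Multiplicative.toAdd (e (↑u⁻¹ : M)) = 0 := by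
    rw [← toAdd_mul, ← map_mul, Units.mul_inv, map_one, toAdd_one]
  apply e.injective
  rw [map_one]
  exact Multiplicative.toAdd.injective (add_eq_zero.mp hsum).1

end Realification

/-! ### `Φ₀|_D` and `B₀|_D` are monoids on a base `D` of FSM-type -/

namespace PadicFrd

/-- The underlying map of an isomorphism of `CommMonCat` is bijective. [cite: MochizukiFrdI2008, Def. 1.1(ii) p.19] -/
private theorem bijective_hom_of_isIso {X Y : CommMonCat.{u}} (f : X ⟶ Y) [IsIso f] :
    Bijective f.hom := by
  refine Function.bijective_iff_has_inverse.mpr ⟨(inv f).hom, fun x => ?_, fun y => ?_⟩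
  · change (f ≫ inv f).hom x = x
    rw [IsIso.hom_inv_id]
    rfl
  · change (inv f ≫ f).hom y = y
    rw [IsIso.inv_hom_id]
    rfl

variable {D : Type u} [Category.{v} D] {p : ℕ} [Fact p.Prime]

/-- `ord(O_L^⊳) → ord(O_K^⊳)` along a valuative `σ : L → K` is injective: classes are detected by
valuations, which `σ` preserves and reflects. [cite: MochizukiFrdII2008, Ex 1.1 (i) p.7] -/
theorem ordIntMapOfHom_injective {K L : Type u} [Field K] [ValuativeRel K] [Field L] [ValuativeRel L]
    (σ : L →+* K) (hσ : IsValHom σ) : Injective (ordIntMapOfHom σ hσ) := by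
  intro x y hxy
  obtain ⟨a, rfl⟩ := Associates.mk_surjective x
  obtain ⟨b, rfl⟩ := Associates.mk_surjective y
  rw [ordIntMapOfHom_mk, ordIntMapOfHom_mk, associatesMk_eq_iff_valuation_eq] at hxy
  rw [associatesMk_eq_iff_valuation_eq]
  rw [← Valuation.veq_iff_eq, veq_def] at hxy ⊢
  exact ⟨(hσ _ _).mp hxy.1, (hσ _ _).mp hxy.2⟩

/-- **Example 1.1 (i)/(ii)**: `Φ₀|_D : Spec K ↦ ord(O_K^⊳) ⊗ ℝ_{≥0}` "determines a monoid on `D`"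
([FrdI] Def. 1.1 (ii)) for a base `D → D₀` of FSM-type into finite extensions of `ℚ_p`.
[cite: MochizukiFrdII2008, Ex 1.1 (i) p.7] -/
theorem isMonoidOn_phiZeroOn (base : D ⥤ PadicFld.{u} p) (hD : IsOfFSMType D)
    (hloc : ∀ A : D, (base.obj A).IsPadicLocal) : IsMonoidOn (phiZeroOn base) := by
  refine ⟨fun {A B} g => ?_, fun {A B} g hg => ?_⟩
  · -- (a) characteristic injectivity of `Φ₀(g) = (ord(O_{K_A}^⊳) → ord(O_{K_B}^⊳)) ⊗ ℝ_{≥0}`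
    obtain ⟨instA, hfinA, hcA⟩ := (hloc A).exists_finite
    obtain ⟨instB, hfinB, hcB⟩ := (hloc B).exists_finite
    have hA : IsZMonoprime (OrdInt (base.obj A).K) := by
      letI := instA; haveI := hfinA; exact PadicFld.isZMonoprime_ordInt (base.obj A) hcA
    have hB : IsZMonoprime (OrdInt (base.obj B).K) := by
      letI := instB; haveI := hfinB; exact PadicFld.isZMonoprime_ordInt (base.obj B) hcB
    change IsCharInjective (Realification.map
      (ordIntMapOfHom (base.map g).alg (base.map g).isValHom))
    exact isCharInjective_of_injective_of_isSharp _
      (Realification.map_injective_of_isZMonoprime hA hB _ (ordIntMapOfHom_injective _ _))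
      (IsRMonoprime.isSharp (isRMonoprime_realification (IsMonoprime.ofZ hB)))
  · -- (b) FSM-morphisms of `D` are isomorphisms, hence pull back to isomorphisms
    haveI : IsIso g := hD.isIso_of_isFSM g hg
    haveI : IsIso ((phiZeroOn base).map g.op) := inferInstance
    change Bijective ((phiZeroOn base).map g.op).hom
    exact bijective_hom_of_isIso ((phiZeroOn base).map g.op)

omit [Fact p.Prime] in
/-- **Example 1.1 (i)/(ii)**: `B₀|_D : Spec K ↦ K^×` "determines a group-like monoid on `D`" for a base
`D → D₀` of FSM-type: pull-backs `L^× → K^×` are injective (and `K^×/K^×` is trivial), FSM-morphisms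
pull back to isomorphisms. [cite: MochizukiFrdII2008, Ex 1.1 (i) p.7] -/
theorem isMonoidOn_bZeroOn (base : D ⥤ PadicFld.{u} p) (hD : IsOfFSMType D) :
    IsMonoidOn (bZeroOn base) := by
  refine ⟨fun {A B} g => ?_, fun {A B} g hg => ?_⟩
  · change IsCharInjective (Units.map ((base.map g).alg : (base.obj A).K →* (base.obj B).K))
    refine ⟨Units.map_injective (base.map g).alg.injective, ?_⟩
    haveI : Subsingleton (Associates ((base.obj A).K)ˣ) := ⟨fun x y => by
      obtain ⟨a, rfl⟩ := Associates.mk_surjective x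
      obtain ⟨b, rfl⟩ := Associates.mk_surjective y
      exact Associates.mk_eq_mk_iff_associated.mpr ⟨toUnits (a⁻¹ * b), by simp⟩⟩
    exact injective_of_subsingleton _
  · haveI : IsIso g := hD.isIso_of_isFSM g hg
    haveI : IsIso ((bZeroOn base).map g.op) := inferInstance
    change Bijective ((bZeroOn base).map g.op).hom
    exact bijective_hom_of_isIso ((bZeroOn base).map g.op)

/-- The standing hypothesis `Datum.IsMonoidData` ("`Φ`, `B` are monoids on `D`", [FrdI] Thm. 5.2)
HOLDS for the datum `Datum.zero` of the `p`-adic Frobenioid `C₀|_D` over a base `D → D₀` of FSM-type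
(e.g. `D = D₀`, or `D = B^temp(Π, Π°)⁰` of Ex. 1.3). [cite: MochizukiFrdII2008, Ex 1.1 (ii) p.8] -/
theorem Datum.zero_isMonoidData (base : D ⥤ PadicFld.{u} p) (hloc : ∀ A : D, (base.obj A).IsPadicLocal)
    (hc : IsConnected D) (he : IsTotallyEpimorphic D)
    (hmono : ∀ A : D, IsMonoprime (OrdInt (base.obj A).K)) (hD : IsOfFSMType D) :
    (Datum.zero base hloc hc he hmono).IsMonoidData :=
  ⟨isMonoidOn_phiZeroOn base hD hloc, isMonoidOn_bZeroOn base hD⟩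

end PadicFrd

end Literature.AlgebraicGeometry.Frobenioids
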